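import Summits.HodgeConjecture.HodgeConjecture.Theses.GenericDivisibility
import Literature.AlgebraicGeometry.HodgeTheory.PencilStepBelowMiddleHolds

/-!
# Route GenericDivisibility — `PencilReduction` (item stmt-HodgeConjecture-18852) holds

`PencilReduction` — the Lefschetz-pencil reduction of the Hodge conjecture below the middle degree
(Thomas 2005 Prop. 2; de Cataldo–Migliorini 2009 §4, proof of Prop. 4.5): for `1 ≤ p`, `2p ≤ m`, the
Hodge conjecture in all codimensions for smooth projective `m`-folds and in codimension `p - 1` for
`(m+1)`-folds imply the Hodge conjecture in codimension `p` for smooth projective `(m+1)`-folds.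

The route item re-asks, verbatim, the shared signature already proved for route LinearSystemTorelli
(stmt-HodgeConjecture-1083, `linearSystemTorelli_pencilReduction_proof`); as there, it is a two-line
consequence of the tree's UNCONDITIONAL pencil step
`Literature.AlgebraicGeometry.HodgeTheory.mem_algebraicClasses_of_two_mul_le`
(`HodgeTheory/PencilStepBelowMiddleHolds`), which needs only the first of the two Hodge-conjecture
hypotheses (the codimension-`p - 1` hypothesis is not used).

* `genericDivisibility_pencilReduction_proof : PencilReduction` — closes route item
  stmt-HodgeConjecture-18852 by name.
-/

noncomputable section

set_option linter.dupNamespace false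

open Literature.AlgebraicGeometry.Motives Literature.AlgebraicGeometry.HodgeTheory

namespace Summit.HodgeConjecture.HodgeConjecture.Theorems

/-- **`PencilReduction` holds** (route GenericDivisibility, item stmt-HodgeConjecture-18852): the
pencil step below the middle dimension,
`Literature.AlgebraicGeometry.HodgeTheory.mem_algebraicClasses_of_two_mul_le`
(de Cataldo–Migliorini 2009 §4 / Thomas 2005 Prop. 2, proved in the tree), after discarding the
unused codimension-`p - 1` hypothesis.
[cite: Thomas2005Nodes, §2 Prop. 2] [cite: DecataldoMigliorini2009, §4 Prop. 4.5] -/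
theorem genericDivisibility_pencilReduction_proof :
    Summit.HodgeConjecture.HodgeConjecture.Theses.GenericDivisibility.PencilReduction := by
  intro m p _ hpm hHC _ X hX c hc hpp
  exact mem_algebraicClasses_of_two_mul_le hX hHC p c hpm hc hpp

end Summit.HodgeConjecture.HodgeConjecture.Theorems

end
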